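import Literature.Geometry.Lorentzian.FlatQuietCollarExclusion
import Literature.Geometry.Lorentzian.KerrCurvatureInvariants
import Literature.Geometry.Lorentzian.MinkowskiCauchyDevelopment
import HarnessLib

/-!
# No windowed `C²`-quiet Kerr collar in Minkowski space — the Kretschmann exclusion DISCHARGED,
# and the windowed order-2 collar-margin clause for the Minkowski development (unconditional)

Topic `Geometry/Lorentzian`; everything PROVED, no definitions, no named facts introduced. Companion of
`FlatQuietCollarExclusion.lean` (whose two final theorems take the named fact
`Kerr.kretschmannScalar_closedForm` as a hypothesis) and `KerrCurvatureInvariants.lean` (which has since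
DISCHARGED that fact, `Kerr.kretschmannScalar_closedForm_holds`). Serves crux `TameCensorshipCollarMargin`
(stmt-FinalStateConjecture-17329, route `BartnikGapSettling` of summit `FinalStateConjecture`; lead a1).

The crux `TameCensorshipCollarMargin` as filed carries the UN-windowed collar-margin conjunct
(`∃ χ₁ k₁ δ₁ K₁, ∀ M₁ > 0, …`), which is refuted modulo junk collars
(`Theorems/TameCensorshipCollarMargin/Negative/TameCensorshipCollarMarginFalseOfExtremalJunkCollars.lean`);
every seat on the crux (registrar, rattack, leads 0 / c1 / a1, triage r1-1/2/3, both line planners)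
recommends restating it to the WINDOWED ORDER-2 clause C‴₂ (label window `m₀ ≤ M₁ ≤ m₀⁻¹` and boost
window `max ‖Λ‖ ‖Λ⁻¹‖ ≤ ρ₀` quantified BEFORE `(χ₁, δ₁, K₁)`, `k₁ := 2`;
`Cruxes/TameCensorshipCollarMargin/VERDICT-lead0.md` §2). This file is the kernel certificate that
the restated clause is JUNK-FREE IN FLAT SPACE, now UNCONDITIONALLY:

* `minkowski_noWindowedQuietCollar` — for every window `(m₀, ρ₀)` there is `δ₀ > 0` such that every
  thick Kerr collar chart of Minkowski space with windowed label and boost, smooth on the collar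
  layer, has `C²`-deviation `> δ₀` on its thick slab. This is
  `minkowski_truncDeviationCk_gt_of_window` (`Literature/…/FlatQuietCollarExclusion.lean`,
  Kretschmann exclusion at the equatorial slab point) with its named-fact hypothesis
  `Kerr.kretschmannScalar_closedForm` DISCHARGED by `Kerr.kretschmannScalar_closedForm_holds`
  (`Literature/…/KerrCurvatureInvariants.lean`, Visser arXiv:0706.0622 §3).
* `minkowskiDevelopment_windowedMargin₂` — the second conjunct of the restated property, VERBATIM in
  the shape of `VERDICT_lead0.lean`'s `TameCensorshipCollarMarginW` / `Lines/zdm_spinup_window.lean`'s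
  `WindowedClause₂` (hypothesis of the registered transfer stub `stub_unwindowing`), read for the
  vacuum Cauchy development `Minkowski.vacuumCauchyDevelopment` of the trivial datum: it holds with
  `χ₁ = 0`, `δ₁ = δ₀`, `K₁ = ∅` — vacuously, because no windowed `δ₀`-quiet collar exists there.

So at the one development every lead names as the expected witness against the FILED clause
(far-field extremal-label junk at labels `M₁ → ∞`, Boukholkhal arXiv:2407.19333v2 Thm 1.2), the
RESTATED clause is a theorem: the window is exactly what separates the two texts. Nothing here bears on
the dynamical content of the restated crux (tame weak cosmic censorship, the generic collar third law).

## References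

* M. Visser, *The Kerr spacetime: a brief introduction*, arXiv:0706.0622, §3 (Kretschmann scalar). [arXiv07060622]
* M. Dafermos, G. Holzegel, I. Rodnianski, M. Taylor, arXiv:2104.08222, §1 (near-Kerr charts). [arXiv210408222]
* B. O'Neill, *Semi-Riemannian geometry* (1983), Ch. 3 (curvature of semi-Euclidean space). [ONeill1983]
-/

noncomputable section

open Set
open scoped Manifold ContDiff ENNReal Topology

namespace Literature.Geometry.Lorentzian.KerrWindow

/-- **No windowed `C²`-quiet thick Kerr collar chart exists in Minkowski space (unconditional).**
For every label window `m₀ > 0` and boost bound `ρ₀` there is `δ₀ > 0` such that every thick Kerr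
collar chart `Φ₁` of Minkowski space on the boosted Kerr star background `(Λ, c, M₁, a₁)` with
`m₀ ≤ M₁ ≤ m₀⁻¹`, `|a₁| ≤ M₁`, `‖Λ‖, ‖Λ⁻¹‖ ≤ ρ₀`, smooth on the collar layer `{−1 < t* < 1, r < 3M₁ + 1}`,
has `C²`-deviation `> δ₀` on the thick slab `{t* = 0, M₁ < r ≤ 3M₁}`: the chart metric `Φ₁^*η` is flat
while the background has `|Rm|² = ¾ M₁⁻⁴ ≥ ¾ m₀⁴` at the equatorial slab point `r = 2M₁`
(`minkowski_truncDeviationCk_gt_of_window`, its hypothesis `Kerr.kretschmannScalar_closedForm`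
discharged by `Kerr.kretschmannScalar_closedForm_holds`). [cite: arXiv07060622, §3] -/
theorem minkowski_noWindowedQuietCollar {m₀ : ℝ} (hm₀ : 0 < m₀) (ρ₀ : ℝ) :
    ∃ δ₀ : ℝ, 0 < δ₀ ∧ ∀ (M₁ a₁ : ℝ) (Λ : lorentzGroup) (c : E4) (B : ModelBackground)
      (Φ₁ : B.domain → E4),
      m₀ ≤ M₁ → M₁ ≤ m₀⁻¹ → |a₁| ≤ M₁ →
      ‖((Λ : E4 ≃L[ℝ] E4) : E4 →L[ℝ] E4)‖ ≤ ρ₀ → ‖((Λ : E4 ≃L[ℝ] E4).symm : E4 →L[ℝ] E4)‖ ≤ ρ₀ →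
      B = starBackground Λ c M₁ a₁ (fun x ↦ Kerr.radius a₁ (poincareInv Λ c x)) →
      ContMDiffOn 𝓘(ℝ, E4) 𝓘(ℝ, E4) ∞ Φ₁
        {x | -1 < B.time x.1 ∧ B.time x.1 < 1 ∧ B.radius x.1 < 3 * M₁ + 1} →
      ENNReal.ofReal δ₀ < Minkowski.spacetime.truncDeviationCk B Φ₁ 2 (3 * M₁) 0 :=
  minkowski_truncDeviationCk_gt_of_window Kerr.kretschmannScalar_closedForm_holds hm₀ ρ₀

/-- **The restated (windowed, order-`2`, boost-bounded) collar-margin clause holds for the Minkowski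
development of the trivial datum — unconditionally and vacuously.** For every window `0 < m₀`, `0 < ρ₀`
there are `χ₁ = 0 < 1`, `δ₁ > 0` and the compact `K₁ = ∅` such that every thick Kerr collar chart of
`Minkowski.vacuumCauchyDevelopment` with label `m₀ ≤ M₁ ≤ m₀⁻¹`, boost `max ‖Λ‖ ‖Λ⁻¹‖ ≤ ρ₀`, `|a₁| ≤ M₁`,
smooth on and an open embedding of the collar layer, `δ₁`-quiet in `C²` on its thick slab and late
w.r.t. `K₁`, has `|a₁| ≤ χ₁ M₁` — because no such chart exists (`minkowski_noWindowedQuietCollar`).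
The statement is VERBATIM the second conjunct of the restated crux C‴₂
(`TameCensorshipCollarMarginW` of `Cruxes/TameCensorshipCollarMargin/VERDICT_lead0.lean` §2 = the
hypothesis of the registered stub `stub_unwindowing` of `Lines/zdm_spinup_window.lean`) specialised to
`𝒟 := Minkowski.vacuumCauchyDevelopment`; contrast the filed un-windowed conjunct, refuted there modulo
extremal-label junk collars. [cite: arXiv07060622, §3] -/
theorem minkowskiDevelopment_windowedMargin₂ :
    ∀ m₀ ρ₀ : ℝ, 0 < m₀ → 0 < ρ₀ →
      ∃ (χ₁ : ℝ) (δ₁ : ENNReal) (K₁ : Set Minkowski.vacuumCauchyDevelopment.carrier),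
        χ₁ < 1 ∧ 0 < δ₁ ∧ IsCompact K₁ ∧
        ∀ (M₁ a₁ : ℝ) (mo₁ : lorentzGroup × E4) (B₁ : ModelBackground)
          (Φ₁ : B₁.domain → Minkowski.vacuumCauchyDevelopment.carrier),
          m₀ ≤ M₁ → M₁ ≤ m₀⁻¹ →
          max ‖((mo₁.1 : E4 ≃L[ℝ] E4) : E4 →L[ℝ] E4)‖ ‖((mo₁.1 : E4 ≃L[ℝ] E4).symm : E4 →L[ℝ] E4)‖ ≤ ρ₀ →
          |a₁| ≤ M₁ →
          B₁ = starBackground mo₁.1 mo₁.2 M₁ a₁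
            (fun x => Kerr.radius a₁ (poincareInv mo₁.1 mo₁.2 x)) →
          ContMDiffOn 𝓘(ℝ, E4) (𝓡 4) ((⊤ : ℕ∞) : WithTop ℕ∞) Φ₁
            {x | -1 < B₁.time x.1 ∧ B₁.time x.1 < 1 ∧ B₁.radius x.1 < 3 * M₁ + 1} →
          Topology.IsOpenEmbedding
            ({x | -1 < B₁.time x.1 ∧ B₁.time x.1 < 1 ∧ B₁.radius x.1 < 3 * M₁ + 1}.restrict Φ₁) →
          Minkowski.vacuumCauchyDevelopment.toSpacetime.truncDeviationCk B₁ Φ₁ 2 (3 * M₁) 0 ≤ δ₁ →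
          Disjoint (Φ₁ '' B₁.truncTimeSlab (3 * M₁) 0)
            (Minkowski.vacuumCauchyDevelopment.metric.causalPast
              Minkowski.vacuumCauchyDevelopment.timeOrientation K₁) →
          |a₁| ≤ χ₁ * M₁ := by
  intro m₀ ρ₀ hm₀ _
  obtain ⟨δ₀, hδ₀, H⟩ := minkowski_noWindowedQuietCollar hm₀ ρ₀
  refine ⟨0, ENNReal.ofReal δ₀, ∅, zero_lt_one, ENNReal.ofReal_pos.2 hδ₀, isCompact_empty, ?_⟩
  intro M₁ a₁ mo₁ B₁ Φ₁ hlo hhi hmo ha hB hΦ _ hdev _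
  exact absurd hdev (not_le.2 (H M₁ a₁ mo₁.1 mo₁.2 B₁ Φ₁ hlo hhi ha ((le_max_left _ _).trans hmo)
    ((le_max_right _ _).trans hmo) hB hΦ))

end Literature.Geometry.Lorentzian.KerrWindow

end
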